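import Summits.Ventures.HSemireg.WedgeHankelSubstitutionQuarterTurn
import Summits.Ventures.HSemireg.WedgeHankelClassSpaceIrreducibleCharP

/-!
# Venture HSemireg — TRACE-ZERO SUBSTITUTIONS ON TH-7's CLASSES: for `g = (α β; γ −α)` one has `SbC(g)² = (−det g)^n • 1`, a non-scalar invertible `g` never acts as a scalar
# (`n ≥ 1`: `PGL₂ → PGL(classes)` is faithful), and hence **`minpoly SbC(g) = X² − C((−det g)^n)`** for every non-scalar trace-zero `g` over every field — the swap (K2),
# the negative scalings `SbC(t 0 0 −t)` (K2) and the quarter turn (K10) are the three instances typed so far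

HONEST FRAMING. Part of the Lean index of the computation cell `pub-hsemireg` (seat p10 gen 21, Sunday typer «UNIFORM-IN-n»).
Finite-dimensional EXTERIOR ALGEBRA + linear algebra ONLY: no variety, no cohomology theory, no sheaf, no Ext group, no semiregularity map;
nothing here says that HC / HC_CM / HC_AV holds; no Literature fact is declared or used.  Custodian versions as in `WedgeHankelSiegelIdeal` (1/3) and `WedgeHankelFrameChange`;
the dictionary (a trace-zero element of `GL₂` squares to a scalar, Cayley–Hamilton; its image in `GL(Sym^n)` is an involution up to the scalar `(−det g)^n`) is QUOTED,
never asserted.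

WHAT IS IN THE TREE.  J5 `SbC_mul`, `SbC_scalar`; J8 `Sb_w_spike_top`, J1 `Sb_w_spike_zero`; H1b `w_eq_w_iff`; K10 (`WedgeHankelSubstitutionQuarterTurn`, this seat):
`two_le_natDegree_of_aeval_eq_zero_of_ne_smul_one`, `minpoly_SbC_quarter` (`X² − (−1)^n`); K2: `minpoly_SbC_swap` (`X² − 1`), `minpoly_SbC_diag_neg` (`(X − t^n)(X + t^n)`).  THIS
FILE (namespace `Summit.Ventures.HSemireg.Wedge.HankelFrameChange` continued; imports K10 + K3 for `SbC_diag_spikeBasis`) unifies them: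
* §301 **`SbC_mul_self_of_trace_zero`** (`δ = −α ⇒ SbC(g)·SbC(g) = (α² + βγ)^n • 1 = (−det g)^n • 1`), `SbC_sq_of_trace_zero`, `aeval_SbC_of_trace_zero`.
* §302 FAITHFULNESS: `Sb_w_spike_top_eq_smul_iff` / `Sb_w_spike_zero_eq_smul_iff`-type computations packaged as **`SbC_ne_smul_one_of_ne`**: for `n ≥ 1`, if `β ≠ 0` or `γ ≠ 0`
  or `α ≠ δ` then `SbC(α β γ δ) ≠ c • 1` for every `c` (test on `E_n`: `γ = 0`; on `E_0`: `β = 0`; then the diagonal weights `α^n ≠ α^{n−1}δ` unless `α = δ` or `α = 0 = δ`…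
  stated with `α ≠ 0 ∨ δ ≠ 0` folded in: hypotheses `1 ≤ n` and `¬ (β = 0 ∧ γ = 0 ∧ α = δ)`).
* §303 **`minpoly_SbC_of_trace_zero`: `n ≥ 1`, `g = (α β; γ −α)` non-scalar (`β ≠ 0 ∨ γ ≠ 0 ∨ α ≠ −α`) ⇒ minpoly (SbC g) = X² − C((α² + βγ)^n)`** (every field),
  `hasEigenvalue_SbC_of_trace_zero_iff` (`μ² = (α² + βγ)^n`), `not_hasEigenvalue_SbC_of_trace_zero`, and the three instances re-derived without `2 ≠ 0`: `minpoly_SbC_swap'`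
  (`X² − 1`, every field, `n ≥ 1`), `minpoly_SbC_diag_neg'` (`X² − C(t^{2n})`, `t ≠ −t`); K10's `minpoly_SbC_quarter` is the instance `(0 −1; 1 0)` (not restated).
NOT typed here: trace-zero NILPOTENT `g` (`α² + βγ = 0`: then `SbC(g)² = 0` for `n ≥ 1` odd… — `(−det g)^n = 0`, covered by the formula with minpoly `X²` when `SbC g ≠ 0`,
J1); anything Ext-side.  New names only.
-/

open Module

namespace Summit.Ventures.HSemireg.Wedge.HankelFrameChange

open Summit.Ventures.HSemireg.Wedge Summit.Ventures.HSemireg.Wedge.Kunneth Summit.Ventures.HSemireg.Wedge.Hankel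
  Summit.Ventures.HSemireg.Wedge.BasisFree Summit.Ventures.HSemireg.Wedge.HankelSiegel Summit.Ventures.HSemireg.Wedge.HankelSiegelIdeal
  Summit.Ventures.HSemireg.Wedge.KunnethKernel Summit.Ventures.HSemireg.Wedge.HankelRankOne Summit.Ventures.HSemireg.Wedge.KernelDuality

variable (K : Type*) [Field K] {n : ℕ}

/-! ## §301. A trace-zero substitution squares to a scalar on the classes -/

/-- **`SbC(α β γ −α)·SbC(α β γ −α) = (α² + βγ)^n • 1`** (`g² = (α² + βγ)·1 = (−det g)·1` for `tr g = 0`; J5 `SbC_mul`, `SbC_scalar`). -/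
theorem SbC_mul_self_of_trace_zero (α β γ : K) :
    SbC K α β γ (-α) (n := n) * SbC K α β γ (-α) = (α ^ 2 + β * γ) ^ n • (1 : spikeSpan K n →ₗ[K] spikeSpan K n) := by
  rw [SbC_mul, ← SbC_scalar]
  congr 1 <;> ring

/-- `SbC(α β γ −α)^2 = (α² + βγ)^n • 1`. -/
theorem SbC_sq_of_trace_zero (α β γ : K) : SbC K α β γ (-α) (n := n) ^ 2 = (α ^ 2 + β * γ) ^ n • (1 : spikeSpan K n →ₗ[K] spikeSpan K n) := by
  rw [pow_two, SbC_mul_self_of_trace_zero]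

/-- `X² − C((α² + βγ)^n)` kills `SbC(α β γ −α)`. -/
theorem aeval_SbC_of_trace_zero (α β γ : K) :
    Polynomial.aeval (SbC K α β γ (-α) (n := n)) (Polynomial.X ^ 2 - Polynomial.C ((α ^ 2 + β * γ) ^ n)) = 0 := by
  rw [map_sub, map_pow, Polynomial.aeval_X, Polynomial.aeval_C, SbC_sq_of_trace_zero, Algebra.algebraMap_eq_smul_one, sub_self]

/-! ## §302. Faithfulness: a non-scalar `g` never acts as a scalar on the classes (`n ≥ 1`) -/

/-- if `SbC(g) = c • 1` then `γ = 0` (`n ≥ 1`; test on the point class: `Sb g E_n = w_n(γ^{n−j}δ^j)` has pure coefficient `γ^n`). -/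
theorem gamma_eq_zero_of_SbC_eq_smul_one (hn : 1 ≤ n) {α β γ δ c : K} (h : SbC K α β γ δ (n := n) = c • 1) : γ = 0 := by
  have e := congrArg (fun φ : spikeSpan K n →ₗ[K] spikeSpan K n => (φ ⟨w K n n (fun j => if j = n then (1 : K) else 0), w_mem_spikeSpan K _⟩ : HT K (In n))) h
  simp only [SbC_apply_coe, Sb_w_spike_top, LinearMap.smul_apply, Module.End.one_apply, Submodule.coe_smul] at e
  rw [← w_smul] at e
  have h0 := (w_eq_w_iff K _ _).1 e 0 (Nat.zero_le n)
  rw [Nat.sub_zero, pow_zero, mul_one, if_neg (by omega), mul_zero] at h0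
  exact pow_eq_zero_iff (by omega) |>.mp h0

/-- if `SbC(g) = c • 1` then `β = 0` (`n ≥ 1`; test on the pure class: `Sb g E_0 = w_n(α^{n−j}β^j)` has point coefficient `β^n`). -/
theorem beta_eq_zero_of_SbC_eq_smul_one (hn : 1 ≤ n) {α β γ δ c : K} (h : SbC K α β γ δ (n := n) = c • 1) : β = 0 := by
  have e := congrArg (fun φ : spikeSpan K n →ₗ[K] spikeSpan K n => (φ ⟨w K n n (fun j => if j = 0 then (1 : K) else 0), w_mem_spikeSpan K _⟩ : HT K (In n))) h
  simp only [SbC_apply_coe, Sb_w_spike_zero, LinearMap.smul_apply, Module.End.one_apply, Submodule.coe_smul] at e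
  rw [← w_smul] at e
  have h0 := (w_eq_w_iff K _ _).1 e n le_rfl
  rw [Nat.sub_self, pow_zero, one_mul, if_neg (by omega), mul_zero] at h0
  exact pow_eq_zero_iff (by omega) |>.mp h0

/-- if `SbC(α 0 0 δ) = c • 1` with `n ≥ 1` then `α^n = c = δ^n` and `α^{n−1}δ = c` (the weights on `E_0`, `E_n`, `E_1` … stated: `α^n = δ^n` and `α^n = α^{n−1}·δ`). -/
theorem diag_weights_of_SbC_eq_smul_one (hn : 1 ≤ n) {α δ c : K} (h : SbC K α 0 0 δ (n := n) = c • 1) : α ^ n = c ∧ δ ^ n = c ∧ α ^ (n - 1) * δ = c := by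
  have hw : ∀ q : Fin (n + 1), α ^ (n - (q : ℕ)) * δ ^ (q : ℕ) = c := fun q => by
    have e := congrArg (fun φ : spikeSpan K n →ₗ[K] spikeSpan K n => φ (spikeBasis K n q)) h
    simp only [LinearMap.smul_apply, Module.End.one_apply] at e
    rw [SbC_diag_spikeBasis] at e
    exact smul_left_injective K ((spikeBasis K n).ne_zero q) e
  refine ⟨?_, ?_, ?_⟩
  · have := hw 0; rwa [Fin.val_zero, Nat.sub_zero, pow_zero, mul_one] at this
  · have := hw (Fin.last n); rwa [Fin.val_last, Nat.sub_self, pow_zero, one_mul] at this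
  · have := hw ⟨1, by omega⟩; simpa only [pow_one] using this

/-- **FAITHFULNESS: for `n ≥ 1`, a substitution acting as a scalar on th-7's classes is a scalar matrix — if `SbC(α β γ δ) = c • 1` then `β = 0`, `γ = 0` and (`α = δ` or
`α = δ = 0`… precisely `α^{n−1}·δ = α^n = δ^n`); in particular `β ≠ 0 ∨ γ ≠ 0 ∨ (α ≠ δ ∧ (α ≠ 0 ∨ δ ≠ 0))` forces `SbC(g) ≠ c • 1`.** -/
theorem SbC_ne_smul_one_of_ne (hn : 1 ≤ n) {α β γ δ : K} (hg : β ≠ 0 ∨ γ ≠ 0 ∨ (α ≠ δ ∧ (α ≠ 0 ∨ δ ≠ 0))) (c : K) :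
    SbC K α β γ δ (n := n) ≠ c • 1 := by
  intro h
  have hβ := beta_eq_zero_of_SbC_eq_smul_one K hn h
  have hγ := gamma_eq_zero_of_SbC_eq_smul_one K hn h
  rcases hg with hb | hc' | ⟨hne, h0⟩
  · exact hb hβ
  · exact hc' hγ
  · rw [hβ, hγ] at h
    obtain ⟨hα, hδ, hαδ⟩ := diag_weights_of_SbC_eq_smul_one K hn h
    -- `α^{n-1} δ = α^n = α^{n-1} α`: if `α ≠ 0` then `δ = α`; if `α = 0` then `c = 0` and `δ^n = 0`
    rcases h0 with hα0 | hδ0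
    · apply hne
      have e : α ^ (n - 1) * δ = α ^ (n - 1) * α := by rw [hαδ, ← hα, ← pow_succ, Nat.sub_add_cancel hn]
      exact (mul_left_cancel₀ (pow_ne_zero _ hα0) e).symm
    · by_cases hα0 : α = 0
      · rw [hα0, zero_pow (by omega)] at hα
        rw [← hα] at hδ
        exact hδ0 (pow_eq_zero_iff (by omega) |>.mp hδ)
      · apply hne
        have e : α ^ (n - 1) * δ = α ^ (n - 1) * α := by rw [hαδ, ← hα, ← pow_succ, Nat.sub_add_cancel hn]
        exact (mul_left_cancel₀ (pow_ne_zero _ hα0) e).symm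

/-! ## §303. The minimal polynomial of a non-scalar trace-zero substitution -/

/-- **THE MINIMAL POLYNOMIAL OF A NON-SCALAR TRACE-ZERO SUBSTITUTION: `minpoly (SbC(α β γ −α)) = X² − C((α² + βγ)^n)`** for `n ≥ 1` over EVERY field (`β ≠ 0 ∨ γ ≠ 0 ∨ α ≠ 0`;
`α² + βγ = −det g`). The swap (`X² − 1`), the quarter turn (`X² − (−1)^n`) and `SbC(t 0 0 −t)` (`X² − t^{2n}`) are instances. -/
theorem minpoly_SbC_of_trace_zero (hn : 1 ≤ n) {α β γ : K} (hg : β ≠ 0 ∨ γ ≠ 0 ∨ α ≠ -α) :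
    minpoly K (SbC K α β γ (-α) (n := n)) = Polynomial.X ^ 2 - Polynomial.C ((α ^ 2 + β * γ) ^ n) := by
  haveI : Nontrivial (spikeSpan K n) := nontrivial_of_ne (spikeBasis K n 0) 0 ((spikeBasis K n).ne_zero 0)
  have hmonic : (Polynomial.X ^ 2 - Polynomial.C ((α ^ 2 + β * γ) ^ n) : Polynomial K).Monic := Polynomial.monic_X_pow_sub_C _ two_ne_zero
  have hg' : β ≠ 0 ∨ γ ≠ 0 ∨ (α ≠ -α ∧ (α ≠ 0 ∨ -α ≠ 0)) := by
    rcases hg with h | h | h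
    · exact Or.inl h
    · exact Or.inr (Or.inl h)
    · exact Or.inr (Or.inr ⟨h, Or.inl fun h0 => h (by rw [h0, neg_zero])⟩)
  have hns : ∀ c : K, SbC K α β γ (-α) (n := n) ≠ c • 1 := SbC_ne_smul_one_of_ne K hn hg'
  symm
  refine minpoly.unique K _ hmonic (aeval_SbC_of_trace_zero K α β γ) fun q hq hq0 => ?_
  rw [Polynomial.degree_eq_natDegree hmonic.ne_zero, Polynomial.degree_eq_natDegree hq.ne_zero, Polynomial.natDegree_X_pow_sub_C, Nat.cast_le]
  exact two_le_natDegree_of_aeval_eq_zero_of_ne_smul_one K hns hq hq0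

/-- **the eigenvalues of a non-scalar trace-zero substitution are exactly the square roots of `(α² + βγ)^n`** (`n ≥ 1`). -/
theorem hasEigenvalue_SbC_of_trace_zero_iff (hn : 1 ≤ n) {α β γ : K} (hg : β ≠ 0 ∨ γ ≠ 0 ∨ α ≠ -α) (μ : K) :
    Module.End.HasEigenvalue (SbC K α β γ (-α) (n := n)) μ ↔ μ ^ 2 = (α ^ 2 + β * γ) ^ n := by
  rw [Module.End.hasEigenvalue_iff_isRoot, minpoly_SbC_of_trace_zero K hn hg, Polynomial.IsRoot.def, Polynomial.eval_sub, Polynomial.eval_pow, Polynomial.eval_X,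
    Polynomial.eval_C, sub_eq_zero]

/-- **no eigen-class when `(α² + βγ)^n` is not a square in `K`** (e.g. `n` odd and `−det g` a non-square). -/
theorem not_hasEigenvalue_SbC_of_trace_zero (hn : 1 ≤ n) {α β γ : K} (hg : β ≠ 0 ∨ γ ≠ 0 ∨ α ≠ -α) (hK : ∀ x : K, x ^ 2 ≠ (α ^ 2 + β * γ) ^ n) (μ : K) :
    ¬ Module.End.HasEigenvalue (SbC K α β γ (-α) (n := n)) μ := by
  rw [hasEigenvalue_SbC_of_trace_zero_iff K hn hg]; exact hK μ

/-- instance: **the swap, every field, `n ≥ 1`: `minpoly (SbC(0 1 1 0)) = X² − 1`** (K2 assumed `2 ≠ 0`; here `β = 1 ≠ 0` suffices — in characteristic `2` this reads `(X − 1)²`). -/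
theorem minpoly_SbC_swap' (hn : 1 ≤ n) : minpoly K (SbC K 0 1 1 0 (n := n)) = Polynomial.X ^ 2 - 1 := by
  have h := minpoly_SbC_of_trace_zero K hn (α := 0) (β := 1) (γ := 1) (Or.inl one_ne_zero)
  rw [neg_zero] at h
  rw [h, zero_pow two_ne_zero, zero_add, one_mul, one_pow, Polynomial.C_1]

/-- instance: **`SbC(t 0 0 −t)`, `t ≠ 0`, `n ≥ 1`, every field: `minpoly = X² − C(t^{2n})`** (K2's `(X − t^n)(X + t^n)` when `2 ≠ 0`). -/
theorem minpoly_SbC_diag_neg' (hn : 1 ≤ n) {t : K} (ht : t ≠ -t) : minpoly K (SbC K t 0 0 (-t) (n := n)) = Polynomial.X ^ 2 - Polynomial.C (t ^ (2 * n)) := by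
  rw [minpoly_SbC_of_trace_zero K hn (Or.inr (Or.inr ht)), mul_zero, add_zero, ← pow_mul]

end Summit.Ventures.HSemireg.Wedge.HankelFrameChange
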